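import Literature.RingTheory.SymmetricFunctions.SchurColumn
import Literature.RepresentationTheory.FiniteGroups.SymmetricGroupFrobeniusOrthogonality
import HarnessLib

/-!
# The Littlewood–Richardson rule for a rectangle: `c^{(a^n)}_{β α} = [β is the complement of α]`

Topic `RingTheory/SymmetricFunctions`; namespace `Literature.RingTheory.SymmetricFunctions.SymmPoly`
(sequel to `SchurPolynomials`: Jacobi–Trudi Schur polynomials `schur`, bialternants `alternant`,
`alternant_add_rho`). Everything here is PROVED; no named fact, no instance.

For weights `α, β ∈ ℕⁿ` (antitone, i.e. partitions with at most `n` parts) and `a ∈ ℕ`, the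
Littlewood–Richardson coefficient of the rectangle `R = (aⁿ)` is, at the level of Schur
POLYNOMIALS in `n` variables, the coefficient
`c^R_{βα} = [x^{R+ρ}] ( a_{β+ρ}(x) · s_α(x) )` (`ρ = (n-1, …, 1, 0)`; this is
`⟨s_R, s_β s_α⟩` since `a_{β+ρ} = s_β a_ρ` and `[x^{γ+ρ}](f a_ρ)` is the coefficient of `s_γ` in a
symmetric polynomial `f`). The classical rule (e.g. Ikenmeyer–Panova, Adv. Math. 319 (2017), proof of
Prop. 6.4: "`c^{(d×n)}_{δγ} = 1` if `δ_i + γ_{d+1-i} = n` for all `i`, `0` otherwise … the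
rectangular Littlewood–Richardson coefficients are equal to `1` only when the partitions complement
each other inside the rectangle"; Pak–Panova, J. Algebraic Combin. 40 (2014), proof of Lemma 1.3)
is PROVED here (`coeff_rect_alternant_mul_schur`):

  `[x^{(aⁿ)+ρ}] (a_{β+ρ}(X) s_α(X)) = 1` if `α_i ≤ a` for all `i` and `β_j = a - α_{n-1-j}` for all
  `j`, and `= 0` otherwise.

## Proof (division-free bookkeeping of the duality `s_R · s_α(x⁻¹) = s_{αᶜ}(x)`)

Write `K^α_m = [x^m] s_α(X)` (the monomial coefficients of the Schur polynomial; no value of a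
Kostka number is ever needed).
1. *Reversal* (`coeff_schur_X_eq_coeff_boxCompl`): for `A ≥ α_i`, `K^α_m = K^{α̃}_{A·𝟙 - m}` if
   `m ≤ A·𝟙` and `K^α_m = 0` otherwise, where `α̃_j = A - α_{n-1-j}` — the polynomial identity
   `x^{A𝟙} s_α(x⁻¹) = s_{α̃}(x)`, proved in the fraction field of `ℤ[X]` from the bialternant formula
   (`a_μ(x⁻¹) · x^{L𝟙}` is again an alternant, rows reversed) and transported back along the
   injective map `ℤ[X] → Frac ℤ[X]`.
2. *Symmetry* `K^α_{m∘π} = K^α_m` (`s_α` is a symmetric polynomial).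
3. `[x^{a𝟙+ρ}](a_{β+ρ} s_α) = ∑_τ sign(τ) K^α_{a𝟙+ρ-(β+ρ)∘τ⁻¹}` (`coeff_alternant_mul`); by 1. and 2.
   this is `∑_τ sign(τ) K^{α̃}_{β+ρ-ρ∘τ}` (`α̃` the complement of `α` in the `a × n` box; the
   terms dropped on either side vanish), which is `[x^{β+ρ}](a_ρ s_{α̃}) = [x^{β+ρ}] a_{α̃+ρ} =
   [β = α̃]`.
The count of complementary pairs in a box (`sum_sum_ite_boxCompl_eq_card`) is recorded for the consumers
(Sylvester's formula / two-row Kronecker coefficients,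
`Literature/Computability/AlgebraicComplexity/TwoRowRectangleKronecker.lean`).

## References

* C. Ikenmeyer, G. Panova, *Rectangular Kronecker coefficients and plethysms in geometric complexity
  theory*, Adv. Math. 319 (2017) 40–66 = arXiv:1512.03798, proof of Prop. 6.4 (TeX L1399–1404)
  and of Prop. 6.9 (L1478–1480). [IkenmeyerPanova2017]
* I. Pak, G. Panova, *Unimodality via Kronecker products*, J. Algebraic Combin. 40 (2014)
  1103–1120 = arXiv:1304.5044, Lemma 1.3 (Main Lemma) and its proof. [PakPanova2014Unimodality]
* I. G. Macdonald, *Symmetric Functions and Hall Polynomials*, 2nd ed. (1995), Ch. I §3–§5.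
  [Macdonald1995]

## Mathlib and tree

Mathlib: `FractionRing`, `IsFractionRing.injective`, `MvPolynomial.aeval`, `MvPolynomial.rename`,
`MvPolynomial.coeff_rename_mapDomain`, `Matrix.det_mul_column`, `MvPolynomial.as_sum`.
Tree: `schur`, `alternant`, `rho`, `alternant_add_rho`, `alternant_comp_perm`, `map_schur`,
`map_alternant`, `alternant_rho_ne_zero`, `eq_of_add_rho_comp_perm_eq` (`SchurPolynomials`),
`alternant_add_const` (`SchurColumn`);
`coeff_alternant_mul`, `alternant_X_eq_sum_monomial` (`SymmetricGroupFixedWords`); `coeff_alternant_X`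
(`SymmetricGroupFrobeniusOrthogonality`).
-/

noncomputable section

open scoped BigOperators
open MvPolynomial Finset Equiv
open Literature.RepresentationTheory.FiniteGroups (prod_X_pow_eq_monomial' coeff_alternant_X
  coeff_alternant_X_self coeff_alternant_mul alternant_X_eq_sum_monomial)

namespace Literature.RingTheory.SymmetricFunctions.SymmPoly

variable {n : ℕ}

/-! ### Symmetry of the Schur polynomial in its variables -/

/-- `H(t)` is symmetric in the variables. [folklore] -/
private theorem hGen_comp_perm {R : Type*} [CommRing R] (x : Fin n → R) (σ : Perm (Fin n)) :
    hGen (x ∘ σ) = hGen x := by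
  unfold hGen
  exact Equiv.prod_comp σ (fun i => geom (x i))

/-- `h_k` (with integer index) is symmetric in the variables (Macdonald I §2: the `h_r` are
symmetric). [cite: Macdonald1995, Ch. I §2] -/
theorem hsymmZ_comp_perm {R : Type*} [CommRing R] (x : Fin n → R) (σ : Perm (Fin n)) (k : ℤ) :
    hsymmZ (x ∘ σ) k = hsymmZ x k := by
  unfold hsymmZ hsymm
  rw [hGen_comp_perm]

/-- The Schur polynomial is symmetric in its variables: `s_λ(x ∘ σ) = s_λ(x)`.
[cite: Macdonald1995, Ch. I (3.1)] -/
theorem schur_comp_perm {R : Type*} [CommRing R] (x : Fin n → R) (σ : Perm (Fin n))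
    (la : Fin n → ℕ) : schur (x ∘ σ) la = schur x la := by
  unfold schur
  simp_rw [hsymmZ_comp_perm]

/-- `rename σ s_λ(X) = s_λ(X)` at the generic point: the Schur polynomial is symmetric. [cite: Macdonald1995, Ch. I §3 (3.1)] -/
theorem rename_schur_X {R : Type*} [CommRing R] (σ : Perm (Fin n)) (la : Fin n → ℕ) :
    rename σ (schur (fun i => (X i : MvPolynomial (Fin n) R)) la) =
      schur (fun i => (X i : MvPolynomial (Fin n) R)) la := by
  rw [show rename σ (schur (fun i => (X i : MvPolynomial (Fin n) R)) la) =
      (rename σ).toRingHom (schur (fun i => (X i : MvPolynomial (Fin n) R)) la) from rfl, map_schur]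
  have : ((rename σ).toRingHom ∘ fun i => (X i : MvPolynomial (Fin n) R)) =
      (fun i => (X i : MvPolynomial (Fin n) R)) ∘ σ := by
    funext i
    simp
  rw [this, schur_comp_perm]

/-- **Symmetry of the monomial coefficients of `s_λ(X)`**: `[x^{m∘π⁻¹}] s_λ = [x^m] s_λ`
(the Schur polynomial is symmetric). [cite: Macdonald1995, Ch. I §3 (3.1)] -/
theorem coeff_schur_X_perm (la : Fin n → ℕ) (m : Fin n → ℕ) (π : Perm (Fin n)) :
    coeff (Finsupp.equivFunOnFinite.symm fun j => m (π⁻¹ j))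
        (schur (fun i => (X i : MvPolynomial (Fin n) ℤ)) la) =
      coeff (Finsupp.equivFunOnFinite.symm m) (schur (fun i => (X i : MvPolynomial (Fin n) ℤ)) la) := by
  have hmd : Finsupp.mapDomain π (Finsupp.equivFunOnFinite.symm m) =
      Finsupp.equivFunOnFinite.symm fun j => m (π⁻¹ j) := by
    ext j
    rw [Finsupp.mapDomain_equiv_apply]
    simp
  rw [← hmd, ← rename_schur_X π la, coeff_rename_mapDomain _ π.injective, rename_schur_X]

/-! ### Shifting all parts: `s_{λ + c𝟙} = (x₁⋯xₙ)^c s_λ` -/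

/-- The generic alternant `a_ρ(X) ∈ ℤ[X]` (the Vandermonde determinant) is nonzero. [cite: Macdonald1995, Ch. I §3 (3.1)] -/
theorem alternant_X_rho_ne_zero :
    alternant (fun i => (X i : MvPolynomial (Fin n) ℤ)) (rho n) ≠ 0 :=
  alternant_rho_ne_zero (MvPolynomial.X_injective)

/-- **Shift of a Schur polynomial** at the generic point: `s_{λ+c𝟙}(X) = (∏ X_i)^c · s_λ(X)`
(the character identity `V_{λ + c𝟙} = det^c ⊗ V_λ`). [cite: Macdonald1995, Ch. I §3 (3.1)] -/
theorem schur_X_add_const (la : Fin n → ℕ) (c : ℕ) :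
    schur (fun i => (X i : MvPolynomial (Fin n) ℤ)) (la + fun _ => c) =
      (∏ i, (X i : MvPolynomial (Fin n) ℤ)) ^ c * schur (fun i => (X i : MvPolynomial (Fin n) ℤ)) la := by
  have h2 : ((la + fun _ => c) + rho n : Fin n → ℕ) = fun j => (la + rho n) j + c := by
    funext i; simp only [Pi.add_apply]; ring
  have key : schur (fun i => (X i : MvPolynomial (Fin n) ℤ)) (la + fun _ => c) *
      alternant (fun i => (X i : MvPolynomial (Fin n) ℤ)) (rho n) =
      ((∏ i, (X i : MvPolynomial (Fin n) ℤ)) ^ c * schur (fun i => (X i : MvPolynomial (Fin n) ℤ)) la) *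
        alternant (fun i => (X i : MvPolynomial (Fin n) ℤ)) (rho n) := by
    rw [← alternant_add_rho, h2, alternant_add_const, alternant_add_rho, mul_assoc]
  exact mul_right_cancel₀ alternant_X_rho_ne_zero key

/-! ### Reversal: `x^{A𝟙} s_α(x⁻¹) = s_{α̃}(x)` with `α̃_j = A - α_{n-1-j}` -/

/-! The complement of a weight `α` in the `A × n` box, rows reversed, is written
`fun j => A - α (Fin.rev j)` throughout ("`β_i = a - α_{b+1-i}`", Ikenmeyer–Panova 2017, proof of
Prop. 6.9; the complement of a Young diagram inside a rectangle, rotated by `180°`). -/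

/-- The box complement of an antitone weight is antitone (a partition). [cite: IkenmeyerPanova2017, proof of Prop. 6.9 (TeX L1478–1480)] -/
theorem boxCompl_antitone (A : ℕ) {α : Fin n → ℕ} (hα : Antitone α) :
    Antitone (fun j => A - α (Fin.rev j)) := by
  intro i j hij
  dsimp only
  have := hα (Fin.rev_le_rev.mpr hij)
  omega

/-- The box complement is an involution on weights inside the box. [cite: IkenmeyerPanova2017, proof of Prop. 6.9 (TeX L1478–1480)] -/
theorem boxCompl_boxCompl (A : ℕ) {α : Fin n → ℕ} (hα : ∀ i, α i ≤ A) :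
    (fun j => A - (fun j => A - α (Fin.rev j)) (Fin.rev j)) = α := by
  funext j
  simp only [Fin.rev_rev]
  have := hα j
  omega

/-- The box complement lies inside the box. [cite: IkenmeyerPanova2017, proof of Prop. 6.9 (TeX L1478–1480)] -/
theorem boxCompl_le (A : ℕ) (α : Fin n → ℕ) (j : Fin n) : A - α (Fin.rev j) ≤ A := by
  omega

/-- `∑_j (A - α_{n-1-j}) + |α| = n A` for `α` inside the box (the two diagrams tile the rectangle). [cite: IkenmeyerPanova2017, proof of Prop. 6.9 (TeX L1478–1480)] -/
theorem sum_boxCompl_add (A : ℕ) {α : Fin n → ℕ} (hα : ∀ i, α i ≤ A) :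
    ∑ j, (A - α (Fin.rev j)) + ∑ j, α j = n * A := by
  rw [← Equiv.sum_comp Fin.revPerm α, ← Finset.sum_add_distrib]
  simp only [Fin.revPerm_apply]
  rw [Finset.sum_congr rfl fun j _ => Nat.sub_add_cancel (hα (Fin.rev j)), Finset.sum_const,
    Finset.card_univ, Fintype.card_fin, smul_eq_mul]

/-- Exponents of a polynomial are bounded by its total degree. [folklore] -/
private theorem apply_le_totalDegree_of_mem_support {Q : MvPolynomial (Fin n) ℤ} {m : Fin n →₀ ℕ}
    (hm : m ∈ Q.support) (i : Fin n) : m i ≤ Q.totalDegree :=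
  (monomial_le_degreeOf i hm).trans (degreeOf_le_totalDegree Q i)

/-- Coefficient extraction from the reversal: `[x^{L𝟙 - m}] rev_L(Q) = [x^m] Q`. [folklore] -/
private theorem coeff_revPoly (L : ℕ) (Q : MvPolynomial (Fin n) ℤ)
    (hQ : ∀ m ∈ Q.support, ∀ i, m i ≤ L) (m₀ : Fin n → ℕ) (hm₀ : ∀ i, m₀ i ≤ L) :
    coeff (Finsupp.equivFunOnFinite.symm fun i => L - m₀ i) ((∑ m ∈ Q.support, monomial (Finsupp.equivFunOnFinite.symm fun i => L - m i) (coeff m Q))) =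
      coeff (Finsupp.equivFunOnFinite.symm m₀) Q := by
  rw [coeff_sum]
  simp_rw [coeff_monomial]
  have key : ∀ m ∈ Q.support,
      (if (Finsupp.equivFunOnFinite.symm fun i => L - m i) =
          Finsupp.equivFunOnFinite.symm fun i => L - m₀ i then coeff m Q else 0) =
        if m = Finsupp.equivFunOnFinite.symm m₀ then coeff m Q else 0 := by
    intro m hm
    congr 1
    apply propext
    constructor
    · intro h
      ext i
      have hi := congr_arg (fun f : Fin n →₀ ℕ => f i) h
      simp only [Finsupp.coe_equivFunOnFinite_symm] at hi
      have h1 := hQ m hm i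
      have h2 := hm₀ i
      simp only [Finsupp.coe_equivFunOnFinite_symm]
      omega
    · intro h
      subst h
      rfl
  rw [Finset.sum_congr rfl key, Finset.sum_ite_eq']
  split_ifs with h
  · rfl
  · exact (notMem_support_iff.mp h).symm

section Reversal

/-- At the point `x⁻¹` in the fraction field of `ℤ[X]`: `a_μ(X⁻¹) · (∏ X_i)^L = a_{L𝟙 - μ}(X)` for
`μ ≤ L𝟙` (multiply row `i` of `det (X_i^{-μ_j})` by `X_i^L`). [folklore] -/
private theorem alternant_inv_mul_prod_pow (μ : Fin n → ℕ) (L : ℕ) (hμ : ∀ j, μ j ≤ L) :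
    alternant (fun i => (algebraMap (MvPolynomial (Fin n) ℤ) (FractionRing (MvPolynomial (Fin n) ℤ))
        (X i))⁻¹) μ *
      algebraMap (MvPolynomial (Fin n) ℤ) (FractionRing (MvPolynomial (Fin n) ℤ))
        ((∏ i, (X i : MvPolynomial (Fin n) ℤ)) ^ L) =
    algebraMap (MvPolynomial (Fin n) ℤ) (FractionRing (MvPolynomial (Fin n) ℤ))
      (alternant (fun i => (X i : MvPolynomial (Fin n) ℤ)) fun j => L - μ j) := by
  set ι := algebraMap (MvPolynomial (Fin n) ℤ) (FractionRing (MvPolynomial (Fin n) ℤ)) with hι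
  have hι_inj : Function.Injective ι := IsFractionRing.injective _ _
  have hX : ∀ i, ι (X i) ≠ 0 := fun i h =>
    MvPolynomial.X_ne_zero i (hι_inj (by rw [h, map_zero]))
  rw [map_alternant, map_pow, map_prod, mul_comm]
  unfold alternant
  rw [← Finset.prod_pow, ← Matrix.det_mul_column]
  congr 1
  ext i j
  simp only [Matrix.of_apply, Function.comp_apply, inv_pow]
  rw [pow_sub₀ _ (hX i) (hμ j)]

/-- `ρ` reversed is its own complement in the `(n-1)`-box: `n - 1 - ρ_j = ρ_{n-1-j} = j`. [folklore] -/
private theorem sub_rho_eq_rho_rev (j : Fin n) : n - 1 - rho n j = rho n (Fin.rev j) := by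
  rw [rho_apply, rho_apply, Fin.val_rev]
  have := j.is_lt
  omega

/-- **Reversal of a Schur polynomial** at the point `x⁻¹` of the fraction field of `ℤ[X]`:
`(∏ X_i)^L · s_γ(X⁻¹) = s_{γ̃}(X)` with `γ̃ = (fun j => L - γ (Fin.rev j))`, for `γ ≤ L𝟙` — from the bialternant
formula, since `(∏X)^M a_μ(X⁻¹) = a_{M𝟙-μ}(X)` is, after reversing the rows, `sign(w₀) a_{μ̃}` for
`μ = γ + ρ` and `sign(w₀) a_ρ` for `μ = ρ`. [cite: Macdonald1995, Ch. I §3 (3.1)] -/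
theorem prod_pow_mul_eval_inv_schur (γ : Fin n → ℕ) (L : ℕ) (hγ : ∀ i, γ i ≤ L) :
    algebraMap (MvPolynomial (Fin n) ℤ) (FractionRing (MvPolynomial (Fin n) ℤ))
        ((∏ i, (X i : MvPolynomial (Fin n) ℤ)) ^ L) *
      eval₂Hom (algebraMap ℤ (FractionRing (MvPolynomial (Fin n) ℤ)))
        (fun i => (algebraMap (MvPolynomial (Fin n) ℤ) (FractionRing (MvPolynomial (Fin n) ℤ))
          (X i))⁻¹) (schur (fun i => (X i : MvPolynomial (Fin n) ℤ)) γ) =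
    algebraMap (MvPolynomial (Fin n) ℤ) (FractionRing (MvPolynomial (Fin n) ℤ))
      (schur (fun i => (X i : MvPolynomial (Fin n) ℤ)) ((fun j => L - γ (Fin.rev j)))) := by
  set ι := algebraMap (MvPolynomial (Fin n) ℤ) (FractionRing (MvPolynomial (Fin n) ℤ)) with hι
  set Xinv : Fin n → FractionRing (MvPolynomial (Fin n) ℤ) := fun i => (ι (X i))⁻¹ with hXinv
  set φ := eval₂Hom (algebraMap ℤ (FractionRing (MvPolynomial (Fin n) ℤ))) Xinv with hφ
  have hι_inj : Function.Injective ι := IsFractionRing.injective _ _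
  have hφX : ((φ : MvPolynomial (Fin n) ℤ →+* _) ∘ fun i => (X i : MvPolynomial (Fin n) ℤ)) = Xinv := by
    funext i
    simp [hφ]
  -- the bialternant formula at the point `X⁻¹`
  have e1 : alternant Xinv (γ + rho n) =
      φ (schur (fun i => (X i : MvPolynomial (Fin n) ℤ)) γ) * alternant Xinv (rho n) := by
    rw [alternant_add_rho, map_schur, hφX]
  -- bounds
  have hρ : ∀ j, rho n j ≤ n - 1 := fun j => by rw [rho_apply]; omega
  have hγρ : ∀ j, (γ + rho n) j ≤ L + (n - 1) := fun j => by
    simp only [Pi.add_apply]; exact Nat.add_le_add (hγ j) (hρ j)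
  -- reverse both alternants
  have r1 := alternant_inv_mul_prod_pow (γ + rho n) (L + (n - 1)) hγρ
  have r2 := alternant_inv_mul_prod_pow (rho n) (n - 1) hρ
  rw [← hι] at r1 r2
  -- identify the reversed exponent vectors
  have hw2 : (fun j => n - 1 - rho n j) = rho n ∘ ⇑Fin.revPerm := by
    funext j
    simp only [Function.comp_apply, Fin.revPerm_apply]
    exact sub_rho_eq_rho_rev j
  have hw1 : (fun j => L + (n - 1) - (γ + rho n) j) = ((fun j => L - γ (Fin.rev j)) + rho n) ∘ ⇑Fin.revPerm := by
    funext j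
    simp only [Function.comp_apply, Fin.revPerm_apply, Pi.add_apply, Fin.rev_rev,
      rho_apply, Fin.val_rev]
    have h2 := hγ j
    have hj := j.is_lt
    omega
  -- sign bookkeeping: `ε² = 1`
  set ε : MvPolynomial (Fin n) ℤ := ((Equiv.Perm.sign (Fin.revPerm : Perm (Fin n)) : ℤ) :
    MvPolynomial (Fin n) ℤ) with hε
  have hε2 : ε * ε = 1 := by
    rw [hε, ← Int.cast_mul, ← Units.val_mul, Int.units_mul_self, Units.val_one, Int.cast_one]
  have hιε2 : ι ε * ι ε = 1 := by rw [← map_mul, hε2, map_one]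
  have r1' : alternant Xinv (γ + rho n) *
      ι ((∏ i, (X i : MvPolynomial (Fin n) ℤ)) ^ (L + (n - 1))) =
      ι ε * (ι (schur (fun i => (X i : MvPolynomial (Fin n) ℤ)) ((fun j => L - γ (Fin.rev j)))) *
        ι (alternant (fun i => (X i : MvPolynomial (Fin n) ℤ)) (rho n))) := by
    rw [r1, hw1, alternant_comp_perm, alternant_add_rho, map_mul, map_mul]
  have r2' : alternant Xinv (rho n) * ι ((∏ i, (X i : MvPolynomial (Fin n) ℤ)) ^ (n - 1)) =
      ι ε * ι (alternant (fun i => (X i : MvPolynomial (Fin n) ℤ)) (rho n)) := by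
    rw [r2, hw2, alternant_comp_perm, map_mul]
  -- combine
  have haρ : ι (alternant (fun i => (X i : MvPolynomial (Fin n) ℤ)) (rho n)) ≠ 0 := fun h =>
    alternant_X_rho_ne_zero (hι_inj (by rw [h, map_zero]))
  have key : ι ((∏ i, (X i : MvPolynomial (Fin n) ℤ)) ^ L) *
        φ (schur (fun i => (X i : MvPolynomial (Fin n) ℤ)) γ) *
        ι (alternant (fun i => (X i : MvPolynomial (Fin n) ℤ)) (rho n)) =
      ι (schur (fun i => (X i : MvPolynomial (Fin n) ℤ)) ((fun j => L - γ (Fin.rev j)))) *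
        ι (alternant (fun i => (X i : MvPolynomial (Fin n) ℤ)) (rho n)) := by
    -- multiply `e1` by `ι(Π^{L+(n-1)}) = ι(Π^L) ι(Π^{n-1})`
    have e2 : alternant Xinv (γ + rho n) *
        ι ((∏ i, (X i : MvPolynomial (Fin n) ℤ)) ^ (L + (n - 1))) =
        φ (schur (fun i => (X i : MvPolynomial (Fin n) ℤ)) γ) * alternant Xinv (rho n) *
          ι ((∏ i, (X i : MvPolynomial (Fin n) ℤ)) ^ (L + (n - 1))) := by rw [e1]
    rw [r1', pow_add, map_mul, show φ (schur (fun i => (X i : MvPolynomial (Fin n) ℤ)) γ) *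
        alternant Xinv (rho n) *
        (ι ((∏ i, (X i : MvPolynomial (Fin n) ℤ)) ^ L) * ι ((∏ i, (X i : MvPolynomial (Fin n) ℤ)) ^ (n - 1))) =
        ι ((∏ i, (X i : MvPolynomial (Fin n) ℤ)) ^ L) * φ (schur (fun i => (X i : MvPolynomial (Fin n) ℤ)) γ) *
          (alternant Xinv (rho n) * ι ((∏ i, (X i : MvPolynomial (Fin n) ℤ)) ^ (n - 1)))
        by ring, r2'] at e2
    -- cancel `ε` (`ε² = 1`)
    calc ι ((∏ i, (X i : MvPolynomial (Fin n) ℤ)) ^ L) *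
          φ (schur (fun i => (X i : MvPolynomial (Fin n) ℤ)) γ) *
          ι (alternant (fun i => (X i : MvPolynomial (Fin n) ℤ)) (rho n))
        = (ι ε * ι ε) * (ι ((∏ i, (X i : MvPolynomial (Fin n) ℤ)) ^ L) *
          φ (schur (fun i => (X i : MvPolynomial (Fin n) ℤ)) γ) *
          ι (alternant (fun i => (X i : MvPolynomial (Fin n) ℤ)) (rho n))) := by rw [hιε2, one_mul]
      _ = ι ε * (ι ((∏ i, (X i : MvPolynomial (Fin n) ℤ)) ^ L) *
          φ (schur (fun i => (X i : MvPolynomial (Fin n) ℤ)) γ) *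
          (ι ε * ι (alternant (fun i => (X i : MvPolynomial (Fin n) ℤ)) (rho n)))) := by ring
      _ = ι ε * (ι ε * (ι (schur (fun i => (X i : MvPolynomial (Fin n) ℤ)) ((fun j => L - γ (Fin.rev j)))) *
          ι (alternant (fun i => (X i : MvPolynomial (Fin n) ℤ)) (rho n)))) := by rw [← e2]
      _ = (ι ε * ι ε) * (ι (schur (fun i => (X i : MvPolynomial (Fin n) ℤ)) ((fun j => L - γ (Fin.rev j)))) *
          ι (alternant (fun i => (X i : MvPolynomial (Fin n) ℤ)) (rho n))) := by ring
      _ = _ := by rw [hιε2, one_mul]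
  exact mul_right_cancel₀ haρ key

/-- `ι(∏ X_i)^L · Q(X⁻¹) = ι(rev_L Q)` for a polynomial with exponents `≤ L`. [folklore] -/
private theorem prod_pow_mul_eval_inv_eq_revPoly (L : ℕ) (Q : MvPolynomial (Fin n) ℤ)
    (hQ : ∀ m ∈ Q.support, ∀ i, m i ≤ L) :
    algebraMap (MvPolynomial (Fin n) ℤ) (FractionRing (MvPolynomial (Fin n) ℤ))
        ((∏ i, (X i : MvPolynomial (Fin n) ℤ)) ^ L) *
      eval₂Hom (algebraMap ℤ (FractionRing (MvPolynomial (Fin n) ℤ)))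
        (fun i => (algebraMap (MvPolynomial (Fin n) ℤ) (FractionRing (MvPolynomial (Fin n) ℤ))
          (X i))⁻¹) Q =
    algebraMap (MvPolynomial (Fin n) ℤ) (FractionRing (MvPolynomial (Fin n) ℤ)) ((∑ m ∈ Q.support, monomial (Finsupp.equivFunOnFinite.symm fun i => L - m i) (coeff m Q))) := by
  set ι := algebraMap (MvPolynomial (Fin n) ℤ) (FractionRing (MvPolynomial (Fin n) ℤ)) with hι
  set Xinv : Fin n → FractionRing (MvPolynomial (Fin n) ℤ) := fun i => (ι (X i))⁻¹ with hXinv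
  set φ := eval₂Hom (algebraMap ℤ (FractionRing (MvPolynomial (Fin n) ℤ))) Xinv with hφ
  have hι_inj : Function.Injective ι := IsFractionRing.injective _ _
  have hX : ∀ i, ι (X i) ≠ 0 := fun i h =>
    MvPolynomial.X_ne_zero i (hι_inj (by rw [h, map_zero]))
  have hmon : ∀ (m : Fin n →₀ ℕ) (c : ℤ), (∀ i, m i ≤ L) →
      ι ((∏ i, (X i : MvPolynomial (Fin n) ℤ)) ^ L) * φ (monomial m c) =
        ι (monomial (Finsupp.equivFunOnFinite.symm fun i => L - m i) c) := by
    intro m c hm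
    have hm1 : monomial m c = C c * ∏ i, (X i : MvPolynomial (Fin n) ℤ) ^ m i := by
      rw [prod_X_pow_eq_monomial', C_mul_monomial, mul_one]
      congr 1
      ext i; simp
    have hm2 : monomial (Finsupp.equivFunOnFinite.symm fun i => L - m i) c =
        C c * ∏ i, (X i : MvPolynomial (Fin n) ℤ) ^ (L - m i) := by
      rw [prod_X_pow_eq_monomial', C_mul_monomial, mul_one]
    rw [hm1, hm2, map_mul, map_mul, map_prod, map_prod, map_pow, map_prod]
    have hc : φ (C c) = ι (C c) := by
      rw [hφ, eval₂Hom_C, eq_intCast, show ι (C c) = (ι.comp C) c from rfl, eq_intCast]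
    rw [hc, show (∏ i, ι (X i)) ^ L * (ι (C c) * ∏ i, φ (X i ^ m i)) =
      ι (C c) * ((∏ i, ι (X i)) ^ L * ∏ i, φ (X i ^ m i)) by ring]
    congr 1
    rw [← Finset.prod_pow, ← Finset.prod_mul_distrib]
    refine Finset.prod_congr rfl fun i _ => ?_
    rw [map_pow, map_pow, hφ, eval₂Hom_X', pow_sub₀ _ (hX i) (hm i), inv_pow]
  conv_lhs => rw [Q.as_sum]
  rw [map_sum, map_sum, Finset.mul_sum]
  exact Finset.sum_congr rfl fun m hm => hmon m _ (hQ m hm)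

/-- **Reversal of the Schur polynomial, polynomial form**: `rev_L(s_γ(X)) = s_{(fun j => L - γ (Fin.rev j))}(X)`
whenever `L` bounds the parts of `γ` and the exponents of `s_γ`. [cite: Macdonald1995, Ch. I §3 (3.1)] -/
theorem revPoly_schur_X (γ : Fin n → ℕ) (L : ℕ) (hγ : ∀ i, γ i ≤ L)
    (hL : ∀ m ∈ (schur (fun i => (X i : MvPolynomial (Fin n) ℤ)) γ).support, ∀ i, m i ≤ L) :
    (∑ m ∈ (schur (fun i => (X i : MvPolynomial (Fin n) ℤ)) γ).support,
        monomial (Finsupp.equivFunOnFinite.symm fun i => L - m i)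
          (coeff m (schur (fun i => (X i : MvPolynomial (Fin n) ℤ)) γ))) =
      schur (fun i => (X i : MvPolynomial (Fin n) ℤ)) ((fun j => L - γ (Fin.rev j))) := by
  apply IsFractionRing.injective (MvPolynomial (Fin n) ℤ) (FractionRing (MvPolynomial (Fin n) ℤ))
  rw [← prod_pow_mul_eval_inv_eq_revPoly L _ hL, prod_pow_mul_eval_inv_schur γ L hγ]

/-- `(∏ X_i)^c` is the monomial `X^{c𝟙}`. [folklore] -/
private theorem prod_X_pow_const_eq_monomial (c : ℕ) :
    (∏ i, (X i : MvPolynomial (Fin n) ℤ)) ^ c =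
      monomial (Finsupp.equivFunOnFinite.symm fun _ : Fin n => c) 1 := by
  rw [← Finset.prod_pow]
  exact prod_X_pow_eq_monomial' (fun _ : Fin n => c)

/-- **The monomial coefficients of a Schur polynomial under reversal** (`x^{A𝟙} s_γ(x⁻¹) =
s_{γ̃}(x)`, `γ̃ = (fun j => A - γ (Fin.rev j))`, the character of `det^A ⊗ V_γ^*`): for `γ ≤ A𝟙`,
`[x^m] s_γ(X) = [x^{A𝟙 - m}] s_{γ̃}(X)` if `m ≤ A𝟙`, and `[x^m] s_γ(X) = 0` if some `m_i > A`
(every monomial of `s_γ` has all exponents at most the largest part).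
[cite: Macdonald1995, Ch. I §3 (3.1)] -/
theorem coeff_schur_X_eq_coeff_boxCompl (γ : Fin n → ℕ) (A : ℕ) (hγ : ∀ i, γ i ≤ A)
    (m : Fin n → ℕ) :
    coeff (Finsupp.equivFunOnFinite.symm m) (schur (fun i => (X i : MvPolynomial (Fin n) ℤ)) γ) =
      if ∀ i, m i ≤ A then
        coeff (Finsupp.equivFunOnFinite.symm fun i => A - m i)
          (schur (fun i => (X i : MvPolynomial (Fin n) ℤ)) ((fun j => A - γ (Fin.rev j))))
      else 0 := by
  set s := schur (fun i => (X i : MvPolynomial (Fin n) ℤ)) γ with hs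
  set L := A + s.totalDegree with hLdef
  have hAL : A ≤ L := Nat.le_add_right _ _
  have hsupp : ∀ m' ∈ s.support, ∀ i, m' i ≤ L := fun m' hm' i =>
    (apply_le_totalDegree_of_mem_support hm' i).trans (Nat.le_add_left _ _)
  have hγL : ∀ i, γ i ≤ L := fun i => (hγ i).trans hAL
  by_cases hmL : ∀ i, m i ≤ L
  · rw [← coeff_revPoly L s hsupp m hmL, revPoly_schur_X γ L hγL hsupp]
    have hcompl : (fun j => L - γ (Fin.rev j)) = (fun j => A - γ (Fin.rev j)) + fun _ => L - A := by
      funext j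
      simp only [Pi.add_apply]
      have := hγ (Fin.rev j)
      omega
    rw [hcompl, schur_X_add_const, prod_X_pow_const_eq_monomial, coeff_monomial_mul']
    by_cases hmA : ∀ i, m i ≤ A
    · rw [if_pos hmA, if_pos, one_mul]
      · congr 1
        ext i
        simp only [Finsupp.coe_tsub, Pi.sub_apply, Finsupp.coe_equivFunOnFinite_symm]
        have := hmA i
        omega
      · intro i
        simp only [Finsupp.coe_equivFunOnFinite_symm]
        have := hmA i
        omega
    · rw [if_neg hmA, if_neg]
      intro h
      apply hmA
      intro i
      have hi := h i
      simp only [Finsupp.coe_equivFunOnFinite_symm] at hi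
      have := hmL i
      omega
  · have hmA : ¬ ∀ i, m i ≤ A := fun h => hmL fun i => (h i).trans hAL
    rw [if_neg hmA]
    by_contra hne
    exact hmL fun i => hsupp _ (mem_support_iff.mpr hne) i

end Reversal

/-! ### The coefficient of a sorted monomial in a sorted alternant -/

/-- `[x^{γ+ρ}] a_{μ+ρ}(X) = [γ = μ]` for antitone `γ, μ` (only the identity permutation sorts a
strictly decreasing exponent vector; Macdonald I §3: the `a_{λ+δ}` form a basis of the antisymmetric
polynomials). [cite: Macdonald1995, Ch. I §3 (3.1)] -/
theorem coeff_add_rho_alternant_X_add_rho {γ μ : Fin n → ℕ} (hγ : Antitone γ) (hμ : Antitone μ) :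
    coeff (Finsupp.equivFunOnFinite.symm (γ + rho n))
        (alternant (fun i => (X i : MvPolynomial (Fin n) ℤ)) (μ + rho n)) =
      if γ = μ then 1 else 0 := by
  by_cases h : γ = μ
  · subst h
    rw [if_pos rfl]
    exact coeff_alternant_X_self (strictAnti_add_rho hγ).injective
  · rw [if_neg h, coeff_alternant_X]
    refine Finset.sum_eq_zero fun τ _ => ?_
    rw [if_neg]
    intro heq
    have hfun : (μ + rho n) ∘ ⇑τ⁻¹ = (γ + rho n) ∘ ⇑(1 : Perm (Fin n)) := by
      funext j
      have := DFunLike.congr_fun heq j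
      simpa [Finsupp.coe_equivFunOnFinite_symm] using this
    exact h (eq_of_add_rho_comp_perm_eq hμ hγ hfun).1.symm

/-! ### The Littlewood–Richardson rule for a rectangle -/

/-- `a_{β+ρ} s_α = a_{α+ρ} s_β` (both are `s_α s_β a_ρ`, bialternant formula). [cite: Macdonald1995, Ch. I §3 (3.1)] -/
theorem alternant_add_rho_mul_schur_comm {R : Type*} [CommRing R] (x : Fin n → R)
    (α β : Fin n → ℕ) :
    alternant x (β + rho n) * schur x α = alternant x (α + rho n) * schur x β := by
  rw [alternant_add_rho, alternant_add_rho]; ring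

/-- If some part of `β` exceeds `a`, then `x^{a𝟙+ρ}` does not occur in `a_{β+ρ}(X) · Q` for any
`Q`: every monomial of `a_{β+ρ}` has an exponent `β₀ + n - 1 > a + n - 1`
(`c^{(aⁿ)}_{βα} = 0` unless `β ⊆ (aⁿ)`). [cite: IkenmeyerPanova2017, proof of Prop. 6.9] -/
theorem coeff_rect_alternant_mul_eq_zero_of_lt (a : ℕ) {β : Fin n → ℕ} (hβ : Antitone β)
    (h : ∃ i, a < β i) (Q : MvPolynomial (Fin n) ℤ) :
    coeff (Finsupp.equivFunOnFinite.symm fun j => a + rho n j)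
        (alternant (fun i => (X i : MvPolynomial (Fin n) ℤ)) (β + rho n) * Q) = 0 := by
  obtain ⟨i₀, hi₀⟩ := h
  have hn : 0 < n := Fin.pos i₀
  rw [coeff_alternant_mul]
  refine Finset.sum_eq_zero fun τ _ => ?_
  rw [if_neg, mul_zero]
  intro hle
  have h0 := Finsupp.le_def.mp hle (τ ⟨0, hn⟩)
  simp only [Finsupp.coe_equivFunOnFinite_symm, Equiv.Perm.coe_inv, Equiv.symm_apply_apply, Pi.add_apply, rho_apply]
    at h0
  have h1 : β i₀ ≤ β ⟨0, hn⟩ := hβ (Fin.le_def.mpr (Nat.zero_le _))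
  have h2 := (τ ⟨0, hn⟩).is_lt
  omega

/-- **The Littlewood–Richardson rule for a rectangle**, main case: if `α ⊆ (aⁿ)` (all parts `≤ a`)
then `[x^{a𝟙+ρ}] (a_{β+ρ}(X) s_α(X)) = [β = (fun j => a - α (Fin.rev j))]` (`β_j = a - α_{n-1-j}`: "the
rectangular Littlewood–Richardson coefficients are equal to `1` only when the partitions complement
each other inside the rectangle", Ikenmeyer–Panova 2017, proof of Prop. 6.4 / Prop. 6.9).
Proof: `[x^{a𝟙+ρ}](a_{β+ρ}s_α) = ∑_τ sign(τ) K^α_{a𝟙+ρ-(β+ρ)∘τ⁻¹} = ∑_τ sign(τ) K^{α̃}_{β+ρ-ρ∘τ}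
= [x^{β+ρ}](a_ρ s_{α̃}) = [x^{β+ρ}] a_{α̃+ρ}` (reversal and symmetry of the monomial coefficients
`K` of Schur polynomials). [cite: IkenmeyerPanova2017, proof of Prop. 6.9] -/
theorem coeff_rect_alternant_mul_schur_of_le (a : ℕ) {α β : Fin n → ℕ} (hα : Antitone α)
    (hβ : Antitone β) (hαa : ∀ i, α i ≤ a) :
    coeff (Finsupp.equivFunOnFinite.symm fun j => a + rho n j)
        (alternant (fun i => (X i : MvPolynomial (Fin n) ℤ)) (β + rho n) *
          schur (fun i => (X i : MvPolynomial (Fin n) ℤ)) α) =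
      if β = (fun j => a - α (Fin.rev j)) then 1 else 0 := by
  set β' := (fun j => a - α (Fin.rev j)) with hβ'def
  have hβ' : Antitone β' := boxCompl_antitone a hα
  have hβ'a : ∀ i, β' i ≤ a := boxCompl_le a α
  set sα := schur (fun i => (X i : MvPolynomial (Fin n) ℤ)) α with hsα
  set sβ' := schur (fun i => (X i : MvPolynomial (Fin n) ℤ)) β' with hsβ'
  -- Step 1: termwise reversal + symmetry
  have step1 : ∀ τ : Perm (Fin n),
      (if (Finsupp.equivFunOnFinite.symm fun j => (β + rho n) (τ⁻¹ j)) ≤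
            Finsupp.equivFunOnFinite.symm fun j => a + rho n j then
          coeff ((Finsupp.equivFunOnFinite.symm fun j => a + rho n j) -
            Finsupp.equivFunOnFinite.symm fun j => (β + rho n) (τ⁻¹ j)) sα
        else 0) =
      if ∀ i, rho n (τ i) ≤ β i + rho n i then
        coeff (Finsupp.equivFunOnFinite.symm fun i => β i + rho n i - rho n (τ i)) sβ'
      else 0 := by
    intro τ
    by_cases h1 : (Finsupp.equivFunOnFinite.symm fun j => (β + rho n) (τ⁻¹ j)) ≤
        Finsupp.equivFunOnFinite.symm fun j => a + rho n j
    · rw [if_pos h1]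
      have h1' : ∀ j, (β + rho n) (τ⁻¹ j) ≤ a + rho n j := fun j => by
        have := Finsupp.le_def.mp h1 j
        simpa [Finsupp.coe_equivFunOnFinite_symm] using this
      have hsub : ((Finsupp.equivFunOnFinite.symm fun j => a + rho n j) -
            Finsupp.equivFunOnFinite.symm fun j => (β + rho n) (τ⁻¹ j)) =
          Finsupp.equivFunOnFinite.symm fun j => a + rho n j - (β + rho n) (τ⁻¹ j) := by
        ext j; simp [Finsupp.coe_equivFunOnFinite_symm]
      rw [hsub, hsα, coeff_schur_X_eq_coeff_boxCompl α a hαa]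
      by_cases h2 : ∀ i, rho n (τ i) ≤ β i + rho n i
      · rw [if_pos h2, if_pos]
        · have hperm := coeff_schur_X_perm β' (fun i => β i + rho n i - rho n (τ i)) τ
          rw [← hsβ'] at hperm
          rw [← hperm]
          congr 2
          funext j
          have e1 := h1' j
          have e2 := h2 (τ⁻¹ j)
          simp only [Pi.add_apply, Equiv.Perm.coe_inv, Equiv.apply_symm_apply] at e1 e2 ⊢
          omega
        · intro j
          have e2 := h2 (τ⁻¹ j)
          simp only [Pi.add_apply, Equiv.Perm.coe_inv, Equiv.apply_symm_apply] at e2 ⊢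
          omega
      · rw [if_neg h2, if_neg]
        intro h3
        apply h2
        intro i
        have e3 := h3 (τ i)
        have e1 := h1' (τ i)
        simp only [Pi.add_apply, Equiv.Perm.coe_inv, Equiv.symm_apply_apply] at e3 e1 ⊢
        omega
    · rw [if_neg h1]
      by_cases h2 : ∀ i, rho n (τ i) ≤ β i + rho n i
      · rw [if_pos h2, hsβ', coeff_schur_X_eq_coeff_boxCompl β' a hβ'a, if_neg]
        intro h3
        apply h1
        refine Finsupp.le_def.mpr fun j => ?_
        simp only [Finsupp.coe_equivFunOnFinite_symm]
        have e3 := h3 (τ⁻¹ j)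
        have e2 := h2 (τ⁻¹ j)
        simp only [Pi.add_apply, Equiv.Perm.coe_inv, Equiv.apply_symm_apply] at e3 e2 ⊢
        omega
      · rw [if_neg h2]
  -- Step 2: the transformed sum is `[x^{β+ρ}] (a_ρ s_{β'})`
  have step2 : coeff (Finsupp.equivFunOnFinite.symm (β + rho n))
      (alternant (fun i => (X i : MvPolynomial (Fin n) ℤ)) (rho n) * sβ') =
      ∑ τ : Perm (Fin n), (Equiv.Perm.sign τ : ℤ) *
        (if ∀ i, rho n (τ i) ≤ β i + rho n i then
          coeff (Finsupp.equivFunOnFinite.symm fun i => β i + rho n i - rho n (τ i)) sβ'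
        else 0) := by
    rw [coeff_alternant_mul, ← Equiv.sum_comp (Equiv.inv (Perm (Fin n)))]
    refine Finset.sum_congr rfl fun τ _ => ?_
    simp only [Equiv.inv_apply, inv_inv, Equiv.Perm.sign_inv]
    congr 1
    have hiff : ((Finsupp.equivFunOnFinite.symm fun j => rho n (τ j)) ≤
        Finsupp.equivFunOnFinite.symm (β + rho n)) ↔ ∀ i, rho n (τ i) ≤ β i + rho n i := by
      rw [Finsupp.le_def]
      simp
    by_cases h2 : ∀ i, rho n (τ i) ≤ β i + rho n i
    · rw [if_pos (hiff.mpr h2), if_pos h2]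
      congr 1
      ext j
      simp
    · rw [if_neg (fun h => h2 (hiff.mp h)), if_neg h2]
  -- Step 3: assemble
  rw [coeff_alternant_mul, Finset.sum_congr rfl fun τ _ => by rw [step1 τ], ← step2, mul_comm,
    ← alternant_add_rho, coeff_add_rho_alternant_X_add_rho hβ hβ']

/-- **The Littlewood–Richardson rule for a rectangle** `(aⁿ)` at the level of Schur polynomials in
`n` variables: for antitone `α, β ∈ ℕⁿ`,
`[x^{a𝟙+ρ}] (a_{β+ρ}(X) · s_α(X)) = 1` if `α ⊆ (aⁿ)` and `β = (fun j => a - α (Fin.rev j))` (`β_j = a - α_{n-1-j}`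
for all `j`), and `0` otherwise — i.e. `c^{(aⁿ)}_{βα} = ⟨s_{(aⁿ)}, s_β s_α⟩ = [β = αᶜ]`
("`c^{(a^b)}_{αβ} = 1` if and only if `β` is the complement of `α` within `(a^b)`, and is `0`
otherwise. In other words, `β_i = a - α_{b+1-i}`", Ikenmeyer–Panova 2017, proof of Prop. 6.9;
also proof of Prop. 6.4 and Pak–Panova 2014, proof of Lemma 1.3).
[cite: IkenmeyerPanova2017, proof of Prop. 6.9 (TeX L1478–1480)] -/
theorem coeff_rect_alternant_mul_schur (a : ℕ) {α β : Fin n → ℕ} (hα : Antitone α)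
    (hβ : Antitone β) :
    coeff (Finsupp.equivFunOnFinite.symm fun j => a + rho n j)
        (alternant (fun i => (X i : MvPolynomial (Fin n) ℤ)) (β + rho n) *
          schur (fun i => (X i : MvPolynomial (Fin n) ℤ)) α) =
      if (∀ i, α i ≤ a) ∧ β = (fun j => a - α (Fin.rev j)) then 1 else 0 := by
  by_cases hαa : ∀ i, α i ≤ a
  · rw [coeff_rect_alternant_mul_schur_of_le a hα hβ hαa]
    by_cases hb : β = (fun j => a - α (Fin.rev j))
    · rw [if_pos hb, if_pos ⟨hαa, hb⟩]
    · rw [if_neg hb, if_neg fun h => hb h.2]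
  · rw [if_neg fun h => hαa h.1, alternant_add_rho_mul_schur_comm]
    simp only [not_forall, not_le] at hαa
    exact coeff_rect_alternant_mul_eq_zero_of_lt a hα hαa _

/-! ### Counting complementary pairs in a box -/

/-- The box complement of `α ⊆ (aⁿ)` with `|α| = s` is an antitone weight of size `n a - s`.
[cite: IkenmeyerPanova2017, proof of Prop. 6.9 (TeX L1478–1480)] -/
theorem boxCompl_mem_antitoneWeights (a : ℕ) {r s : ℕ} (hrs : r + s = n * a) {α : Fin n → ℕ}
    (hα : α ∈ antitoneWeights n s) (hαa : ∀ i, α i ≤ a) : (fun j => a - α (Fin.rev j)) ∈ antitoneWeights n r := by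
  rw [mem_antitoneWeights] at hα ⊢
  refine ⟨?_, boxCompl_antitone a hα.2⟩
  have h := sum_boxCompl_add a hαa
  rw [hα.1] at h
  omega

/-- **Counting complementary pairs**: for `r + s = n a`, the number of pairs `(β, α)` of antitone
weights, `|β| = r`, `|α| = s`, with `α ⊆ (aⁿ)` and `β` the box complement of `α`, is the number of
`α ⊆ (aⁿ)` with `|α| = s` (partitions of `s` with at most `n` parts, all `≤ a`) — the count behind
Sylvester's formula `k_{(N-k,k),(aⁿ),(aⁿ)} = P(k; n × a) - P(k-1; n × a)`.
[cite: PakPanova2014Unimodality, Lemma 1.3 (Main Lemma) and its proof] -/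
theorem sum_sum_ite_boxCompl_eq_card (a : ℕ) {r s : ℕ} (hrs : r + s = n * a) :
    ∑ β ∈ antitoneWeights n r, ∑ α ∈ antitoneWeights n s,
        (if (∀ i, α i ≤ a) ∧ β = (fun j => a - α (Fin.rev j)) then (1 : ℤ) else 0) =
      (((antitoneWeights n s).filter fun α => ∀ i, α i ≤ a).card : ℤ) := by
  rw [Finset.sum_comm]
  have inner : ∀ α ∈ antitoneWeights n s,
      ∑ β ∈ antitoneWeights n r, (if (∀ i, α i ≤ a) ∧ β = (fun j => a - α (Fin.rev j)) then (1 : ℤ) else 0) =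
        if ∀ i, α i ≤ a then 1 else 0 := by
    intro α hα
    by_cases hαa : ∀ i, α i ≤ a
    · rw [if_pos hαa]
      have : ∀ β ∈ antitoneWeights n r,
          (if (∀ i, α i ≤ a) ∧ β = (fun j => a - α (Fin.rev j)) then (1 : ℤ) else 0) =
            if β = (fun j => a - α (Fin.rev j)) then 1 else 0 := fun β _ => by
        by_cases hb : β = (fun j => a - α (Fin.rev j))
        · rw [if_pos hb, if_pos ⟨hαa, hb⟩]
        · rw [if_neg hb, if_neg fun h => hb h.2]
      rw [Finset.sum_congr rfl this, Finset.sum_ite_eq', if_pos]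
      exact boxCompl_mem_antitoneWeights a hrs hα hαa
    · rw [if_neg hαa]
      exact Finset.sum_eq_zero fun β _ => if_neg fun h => hαa h.1
  rw [Finset.sum_congr rfl inner, Finset.sum_boole, Nat.cast_inj]

end Literature.RingTheory.SymmetricFunctions.SymmPoly

end
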